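import Summits.CriticalPhenomena.PercolationContinuityZ3.Theorems.Transplant.BoxProdZ2ConcFaceRegion
import Summits.CriticalPhenomena.PercolationContinuityZ3.Theorems.Transplant.BoxProdZ2ConcAssemblyG
import Summits.CriticalPhenomena.PercolationContinuityZ3.Theorems.Transplant.KNCells2TubeSub
import Summits.CriticalPhenomena.PercolationContinuityZ3.Theorems.Transplant.KNCellsBoxProdZ2ConcHout
import Summits.CriticalPhenomena.PercolationContinuityZ3.Theorems.Transplant.KNCellsBoxProdZ2ConcSepQ
import Summits.CriticalPhenomena.PercolationContinuityZ3.Theorems.Transplant.KNCells2Cover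
import Summits.CriticalPhenomena.PercolationContinuityZ3.Theorems.Transplant.BoxProdZ2ConcExcess
import Summits.CriticalPhenomena.PercolationContinuityZ3.Theorems.Transplant.BoxProdZ2SeedGeom
import HarnessLib

/-!
# The FACE STEP `cond_j` of the concentric `X □ ℤ²` instance (design (D), §11 v2; residue (F)): the fresh regions of the law `Wt` above the
# stub `Stub_j` are subboxes of the tube graph over `B_X(w₀, R)`, `R = rE_{a'}(x, du)`; positive-weight entrances into the maximal fresh
# region `E^far \ Stub_j` land at fibre radius `≤ R₀ + 1` (`R₀` bounds the radii of `E_{w,v}` and of the stub); hence the RIM EXCESS bound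
# of `FaceOblAt` from the collar estimate at the running parameter

builds on p205010 (kernel theorem, internal audit signed; external expert review pending) — nothing in this file uses p205010.
Lane `prim-bschramm`, seat `prim-bschramm-p3` (residue (F) of V56); helper file (`--supports stmt-CriticalPhenomena-4575 --as helper`).

* `faceFresh` (= `E^far_{a'}(x,du) \ Stub_{a'}(x,du,j)`), `Efar_disjoint_Ewv'`, `prod_disjoint_Stub`;
* **`isSubbox_Wt_face`** — `IsSubbox (tubeGraph X B(w₀,R)) Wt q Dd` for every `Dd ⊆ E^far` missing the stub (p2-g2's `isSubbox_Wt_tube` with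
  `levelGeomCG`, `qSepGeomCG`, `tube_adj_of_mem_Ewv_Efar`);
* `Wt_eq_zero_of_not_mem_edgeSet`, **`entrance_face`**, **`rim_excess_face`** (`real_rim_le_of_radius`).
[cite: KozmaNitzan2024, §4 p. 27 ((30)), p. 30 (Step III), p. 31 (D is a subbox of Ω), Lemma 12 (p. 24)] [cite: MartineauSevero2019, Cor. 2.2]
-/

noncomputable section

open MeasureTheory

namespace Summit.CriticalPhenomena.PercolationContinuityZ3.Theorems

namespace Transplant

namespace BoxProdZ2

open Literature.Probability.Percolation Literature.Probability.LatticeModels SimpleGraph KNLevels KNCells GadgetSystem Contour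
open Literature.Probability.Percolation.KozmaNitzan
open Literature.Barriers.CriticalPhenomena (graphBall graphBall_finite mem_graphBall_self graphBall_mono)
open scoped Classical

variable {W : Type} [DecidableEq W] [Countable W] (X : SimpleGraph W) [X.LocallyFinite]
variable (C : PCells) (w₀ : W) (Λ : ConcRadiiG)

/-! ## §1 The fresh regions of the face step -/

/-- **The maximal fresh region of `cond_j`**: the far box minus the stub of level `j`. [cite: KozmaNitzan2024, §4 p. 27 ((30): Ω ∖ D)] -/
def faceFresh (a' : ℕ) (x : Site 2) (du : MDir) (j : ℕ) : Finset (W × Site 2) :=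
  (cellGeomCG X C w₀ Λ).Efar a' x du \ (cellGeomCG X C w₀ Λ).Stub a' x du j

omit [Countable W] in
/-- `E^far` misses `E_{w,v}` of the incoming edge when `du` is not the way back. [cite: KozmaNitzan2024, §4 p. 26] -/
theorem Efar_disjoint_Ewv' (a a' : ℕ) (w : Site 2) {δw du : MDir} (hne : du ≠ rev δw) :
    Disjoint ((cellGeomCG X C w₀ Λ).Efar a' (w + stepVec δw) du) ((cellGeomCG X C w₀ Λ).Ewv a w δw) := by
  rw [Finset.disjoint_left]
  intro y hy hy'
  have h2 : y.2 ∈ C.Efar (w + stepVec δw) du := (Finset.mem_product.1 hy).2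
  have h2' : y.2 ∈ C.Ewv w δw := by
    rw [CellGeom.Ewv] at hy'
    rcases Finset.mem_union.1 hy' with h' | h'
    · exact Finset.mem_union_left _ (Finset.mem_product.1 h').2
    · exact Finset.mem_union_right _ (Finset.mem_product.1 h').2
  exact Finset.disjoint_left.1 (C.Ewv_disjoint_Efar w hne) h2' h2

omit [Countable W] in
/-- A product over a planar set missing the stub rows misses the staircase stub. [folklore] -/
theorem prod_disjoint_Stub {π : Finset W} {P : Finset (Site 2)} {a' : ℕ} {x : Site 2} {du : MDir} {j : ℕ}
    (hP : Disjoint P (C.Stub x du j)) : Disjoint (π ×ˢ P) ((cellGeomCG X C w₀ Λ).Stub a' x du j) := by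
  rw [Finset.disjoint_left]
  intro y hy hy'
  exact Finset.disjoint_left.1 hP (Finset.mem_product.1 hy).2 ((mem_stair X).1 hy').1

omit [Countable W] in
/-- The fibre of a vertex of `E_{w,v}` is within the larger of its two radii. [folklore] -/
theorem fst_mem_of_mem_Ewv {a : ℕ} {v : Site 2} {δ : MDir} {R₀ : ℕ} (hB : Λ.rB a v δ ≤ R₀) (hQ : Λ.rQ a (v + stepVec δ) ≤ R₀)
    {y : W × Site 2} (hy : y ∈ (cellGeomCG X C w₀ Λ).Ewv a v δ) : y.1 ∈ ballFin X w₀ R₀ := by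
  rw [CellGeom.Ewv] at hy
  rcases Finset.mem_union.1 hy with h' | h'
  · exact ballFin_mono X w₀ hB (Finset.mem_product.1 h').1
  · exact ballFin_mono X w₀ hQ (Finset.mem_product.1 h').1

omit [Countable W] in
/-- The fibre of a vertex of the staircase stub is within any bound of its profile. [folklore] -/
theorem fst_mem_of_mem_Stub {a' : ℕ} {x : Site 2} {du : MDir} {j R₀ : ℕ} (hρ : ∀ ℓ, Λ.ρ a' x du ℓ ≤ R₀) {y : W × Site 2}
    (hy : y ∈ (cellGeomCG X C w₀ Λ).Stub a' x du j) : y.1 ∈ ballFin X w₀ R₀ := by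
  obtain ⟨-, hB⟩ := (mem_stair X).1 hy
  exact ballFin_mono X w₀ (hρ _) hB

omit [DecidableEq W] [Countable W] in
/-- Across an edge of `X □ ℤ²` the fibre distance from `w₀` grows by at most one. [folklore] -/
theorem fst_mem_ballFin_succ_of_adj {R₀ : ℕ} {y b : W × Site 2} (hy : y.1 ∈ ballFin X w₀ R₀) (hadj : (X □ zdGraph 2).Adj y b) :
    b.1 ∈ ballFin X w₀ (R₀ + 1) := by
  rw [mem_ballFin] at hy ⊢
  rcases (SimpleGraph.boxProd_adj).1 hadj with ⟨h1, -⟩ | ⟨-, h1⟩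
  · exact mem_graphBall_add X hy ⟨Walk.cons h1 Walk.nil, by simp⟩
  · rw [← h1]; exact graphBall_mono X w₀ (Nat.le_succ _) hy

/-! ## §2 Subboxes, the weighting off the edges, entrances -/

variable {C w₀ Λ}
variable (hΛ : Λ.WF C) {q : unitInterval} {δc : ℝ} {h : ProbeHistory (W × Site 2)} {e : Site 2 × MDir}
variable (hV : (concSchemeG X C w₀ Λ q δc).Valid₂ (X □ zdGraph 2) h e) {a a' : ℕ} {du : MDir}
variable (hdu : du ∈ (concSchemeG X C w₀ Λ q δc).onward (X □ zdGraph 2) h (tgt e)) {j : ℕ} {o : Finset (Sym2 (W × Site 2))}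
include hΛ hV hdu

omit [Countable W] in
/-- **Every `Dd ⊆ E^far_{a'}(x, du)` missing `Stub_j` is a subbox of `Wt` in the tube graph over `B(w₀, rE_{a'}(x, du))`.**
[cite: KozmaNitzan2024, §4 p. 31 (D is a subbox of Ω)] -/
theorem isSubbox_Wt_face {Dd : Finset (W × Site 2)} (hDd : Dd ⊆ (cellGeomCG X C w₀ Λ).Efar a' (tgt e) du)
    (hdS : Disjoint Dd ((cellGeomCG X C w₀ Λ).Stub a' (tgt e) du j)) :
    IsSubbox (tubeGraph X (ballFin X w₀ (Λ.rE a' (tgt e) du))) ((concSchemeG X C w₀ Λ q δc).Wt (X □ zdGraph 2) h e a a' du j o) q Dd := by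
  have hne : du ≠ rev e.2 := KSchA.du_ne_rev₂ hV hdu
  have hdisj : Disjoint (C.Ewv e.1 e.2) (C.Efar (e.1 + stepVec e.2) du) := C.Ewv_disjoint_Efar e.1 hne
  refine KSchA.isSubbox_Wt_tube X (ballFin X w₀ (Λ.rE a' (tgt e) du)) (levelGeomCG X C w₀ hΛ) (qSepGeomCG X C w₀ Λ) hV hdu (b := a)
    (hDd.trans Finset.subset_union_right) ?_ ?_ (fun u hu => (Finset.mem_product.1 (hDd hu)).1) ?_
  · intro u hu; unfold KSchA.Sx; exact Finset.mem_union_right _ (hDd hu)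
  · exact Finset.disjoint_union_right.2 ⟨(Efar_disjoint_Ewv' X C w₀ Λ a a' e.1 hne).mono_left hDd, hdS⟩
  · intro v hv x' hx' hadj
    have hv2 : v.2 ∈ C.Efar (e.1 + stepVec e.2) du := (Finset.mem_product.1 (hDd hv)).2
    refine tube_adj_of_mem_Ewv_Efar (X := X) (C := C) (w₀ := w₀) (Λ := Λ) le_rfl hx' (fun hm => ?_) (Finset.mem_product.1 (hDd hv)).1 hadj
    exact Finset.disjoint_left.1 hdisj hm hv2

omit [Countable W] hΛ hV hdu in
/-- `Wt` vanishes off the edges of `X □ ℤ²`. [folklore] -/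
theorem Wt_eq_zero_of_not_mem_edgeSet {e' : Sym2 (W × Site 2)} (he : e' ∉ (X □ zdGraph 2).edgeSet) :
    (concSchemeG X C w₀ Λ q δc).Wt (X □ zdGraph 2) h e a a' du j o e' = 0 := by
  unfold KSchA.Wt
  by_cases hm : e' ∈ wireSet (↑((concSchemeG X C w₀ Λ q δc).Sx (X □ zdGraph 2) h e a a' du) : Set (W × Site 2))
  · rw [restrW_apply_of_mem _ hm]
    have hF : e' ∉ (↑((concSchemeG X C w₀ Λ q δc).Fj (X □ zdGraph 2) h e a a' du j) : Set (Sym2 (W × Site 2))) := fun h' => by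
      unfold KSchA.Fj at h'
      exact he (mem_edgesIn_iff.1 (Finset.mem_coe.1 h')).1
    rw [pinW_apply_of_not_mem _ _ hF, KNLevels.lattW_apply, if_neg he]
  · exact restrW_apply_of_not_mem _ hm

omit [Countable W] in
/-- **Entrances into the fresh region are fibre-deep**: a positive-weight edge of `Wt` from outside `E^far \\ Stub_j` into it starts in
`E_{w,v}` or in the stub (the explored region is separated), so it lands at fibre radius `≤ R₀ + 1`. [cite: KozmaNitzan2024, §4 pp. 26, 31] -/
theorem entrance_face {R₀ : ℕ} (hB : Λ.rB a e.1 e.2 ≤ R₀) (hQ : Λ.rQ a (tgt e) ≤ R₀) (hρ : ∀ ℓ, Λ.ρ a' (tgt e) du ℓ ≤ R₀)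
    {y b : W × Site 2} (hy : y ∉ faceFresh X C w₀ Λ a' (tgt e) du j) (hb : b ∈ faceFresh X C w₀ Λ a' (tgt e) du j)
    (hadj : (X □ zdGraph 2).Adj y b) (hw : (concSchemeG X C w₀ Λ q δc).Wt (X □ zdGraph 2) h e a a' du j o s(y, b) ≠ 0) :
    b.1 ∈ ballFin X w₀ (R₀ + 1) := by
  have hbE : b ∈ (cellGeomCG X C w₀ Λ).Efar a' (tgt e) du := (Finset.mem_sdiff.1 hb).1
  -- the pair lies inside the support `Sx`
  have hm : s(y, b) ∈ wireSet (↑((concSchemeG X C w₀ Λ q δc).Sx (X □ zdGraph 2) h e a a' du) : Set (W × Site 2)) := by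
    by_contra hm; apply hw; unfold KSchA.Wt; exact restrW_apply_of_not_mem _ hm
  have hyS : y ∈ (concSchemeG X C w₀ Λ q δc).Sx (X □ zdGraph 2) h e a a' du := Finset.mem_coe.1 (mk_mem_wireSet_iff.1 hm).1
  unfold KSchA.Sx at hyS
  rcases Finset.mem_union.1 hyS with hyS | hyE
  · rcases Finset.mem_union.1 hyS with hyV | hyW
    · -- explored: separated from the habitat
      exact absurd hadj ((KSchA.Valid₂.sep_habitat (levelGeomCG X C w₀ hΛ) (qSepGeomCG X C w₀ Λ) hV hdu (a := a) (a' := a') y hyV b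
        (Finset.mem_union_right _ hbE)).2)
    · exact fst_mem_ballFin_succ_of_adj X w₀ (fst_mem_of_mem_Ewv X C w₀ Λ hB hQ hyW) hadj
  · -- in `E^far` but not fresh: in the stub
    have hySt : y ∈ (cellGeomCG X C w₀ Λ).Stub a' (tgt e) du j := by
      by_contra h'; exact hy (Finset.mem_sdiff.2 ⟨hyE, h'⟩)
    exact fst_mem_ballFin_succ_of_adj X w₀ (fst_mem_of_mem_Stub X C w₀ Λ hρ hySt) hadj

/-! ## §3 The rim excess of the face step -/

/-- **The rim excess of the face step is `≤ η`**: for `R = rE_{a'}(x, du)`, `R₁ ≤ Rt - L'` where `R₁` is the excess radius of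
`exists_excess_radius X hT_q {w₀} (R₀ + 1) (25 r) η` at the running parameter, the probability under `Wt` that the root is joined to a
vertex of the far rows above the stub with fibre outside `B(w₀, Rt - L')` is at most `η`. [cite: KozmaNitzan2024, §4 Lemma 12 (p. 24)]
[cite: MartineauSevero2019, Cor. 2.2] -/
theorem rim_excess_face {R₀ : ℕ} (hB : Λ.rB a e.1 e.2 ≤ R₀) (hQ : Λ.rQ a (tgt e) ≤ R₀) (hρ : ∀ ℓ, Λ.ρ a' (tgt e) du ℓ ≤ R₀)
    {Rt L' : ℕ} {η : ℝ} {R₁ : ℕ}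
    (hR₁ : ∀ R', R₁ ≤ R' → ∀ τ ∈ ({w₀} : Finset W), ∀ (Rw : ℕ) (D' A' : Finset (W × Site 2)), D' ⊆ ballFin X τ Rw ×ˢ box 2 (25 * C.r) →
      A' ⊆ D' → (∀ v ∈ A', v.1 ∈ ballFin X τ (R₀ + 1)) → (bondPercolation (X □ zdGraph 2) q).real (excess X τ R' D' A') ≤ η)
    (hR : R₁ ≤ Rt - L') :
    (prodBernoulli ((concSchemeG X C w₀ Λ q δc).Wt (X □ zdGraph 2) h e a a' du j o)).real
      (⋃ t ∈ (ballFin X w₀ (Λ.rE a' (tgt e) du) \ ballFin X w₀ (Rt - L')) ×ˢ C.farA (tgt e) du j, openConn (w₀, (0 : Site 2)) t) ≤ η := by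
  set R := Λ.rE a' (tgt e) du with hRdef
  set D := faceFresh X C w₀ Λ a' (tgt e) du j with hD
  have hDE : D ⊆ (cellGeomCG X C w₀ Λ).Efar a' (tgt e) du := Finset.sdiff_subset
  have hWD : IsSubbox (tubeGraph X (ballFin X w₀ R)) ((concSchemeG X C w₀ Λ q δc).Wt (X □ zdGraph 2) h e a a' du j o) q D :=
    isSubbox_Wt_face X hΛ hV hdu hDE Finset.disjoint_sdiff.symm
  have hroot : ((w₀, (0 : Site 2)) : W × Site 2) ∉ D :=
    KSchA.root_not_mem_of_fresh (levelGeomCG X C w₀ hΛ) (qSepGeomCG X C w₀ Λ) hV hdu (a := a) (hDE.trans Finset.subset_union_right)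
  have hRimD : (ballFin X w₀ R \ ballFin X w₀ (Rt - L')) ×ˢ C.farA (tgt e) du j ⊆ D := by
    intro t ht
    obtain ⟨h1, h2⟩ := Finset.mem_product.1 ht
    refine Finset.mem_sdiff.2 ⟨Finset.mem_product.2 ⟨(Finset.mem_sdiff.1 h1).1, C.farA_subset_Efar _ du j h2⟩, fun h' => ?_⟩
    exact Finset.disjoint_left.1 (C.farA_disjoint_Stub (tgt e) du j) h2 ((mem_stair X).1 h').1
  refine real_rim_le_of_radius X hWD (fun v hv => (Finset.mem_product.1 (hDE hv)).1)
    (fun e' he' => Wt_eq_zero_of_not_mem_edgeSet X he') hroot hRimD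
    (fun t ht => (Finset.mem_sdiff.1 (Finset.mem_product.1 ht).1).2)
    (fun y b hy hb hadj hw => entrance_face X hΛ hV hdu hB hQ hρ hy hb hadj hw) hR₁ hR (Rw := R) (v := C.cen (tgt e)) ?_
  exact hDE.trans (Finset.product_subset_product le_rfl (C.Efar_subset_box_image (tgt e) du))

end BoxProdZ2

end Transplant

end Summit.CriticalPhenomena.PercolationContinuityZ3.Theorems

end
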